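import Summits.CriticalPhenomena.PercolationContinuityZ3.Theorems.Transplant.FKConnectivityAllQHubCovPolarised
import Summits.CriticalPhenomena.PercolationContinuityZ3.Theorems.Transplant.FKConnectivityAllQHubCovPinning
import HarnessLib

/-!
# Connectivity correlation inequalities for `φ_{w,q}`, every `q > 0` — the hub covariance bound, file 6: the POLARISED BOUND as a
# conjecture node and the chain `POL ⇒ HubCovBound ⇔ adjacent-edge NC`

Support file (`--supports stmt-CriticalPhenomena-4575`), FK sub-lane `prim-bschramm-fk-3` (gen 7) of the post-continuity
programme; builds on p205010 (kernel theorem, internal audit signed; external expert review pending).  Two definitions (the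
`q`-family and the conjecture node of the polarised bound), no named facts, no sorries; standard axioms.

CONTENT.  `PolHubCovFK q` — the polarised hub covariance bound `PolHubCovUnder (φ_{w[g↦0]}) (φ_{w[g↦1]}) q x y z` for every finite
weighted graph (vertex types `Fin n`), every pair `g`, hub `x` and pair `y, z`; the node `PolHubCovFKLtOne` (`∀ q ∈ (0,1)`;
`@[conjecture]`, NOT asserted).  PROVED: `PolHubCovFK q → HubCovBoundFK q` (`0 < q`, file 4's induction on undecided pairs), hence
`PolHubCovFKLtOne → HubCovBoundFKLtOne ↔ EdgeNegCorrAdjFKLtOne` (file 5): a proof of the polarised bound proves negative correlation of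
adjacent edges for every `q < 1`.  At the hub pairs the polarised bound carries nothing new: for `g = xy` it is EQUIVALENT to the
hub covariance bound of the deleted state (`polHubCovUnder_hub_pair`, from the pinning identity `TP_w = (1 − w(xy))·TP_{w[xy↦0]}` and
the affine expansion — the polarised term at `g = xy` equals `TP_{w[xy↦0]}`); its content is at pairs away from the hub.
EVIDENCE for the node (gen 7, bschramm/FK-BARRIER.md §11.6): 0 negatives in 13,350 random weighted graphs with `n ≤ 9` (kit j112335 extends
this); it is implied by gen 6's coefficientwise positivity (§10.3) and implies the node `HubCovBoundFKLtOne`; none is proved.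
[cite: Grimmett2006, §3.9 eq. (3.94), Conj. (3.96) (pp. 63–66); Thm. (3.1)(a) (p. 37)] [cite: Wagner2006, Conj. 5.3 (p. 13)]
-/

noncomputable section

namespace Summit.CriticalPhenomena.PercolationContinuityZ3.Theorems

namespace FK

open MeasureTheory Set Literature.Probability.LatticeModels Literature.Probability.Percolation
open Literature.Probability.Percolation.DecisionTree (ind ind_of_mem ind_of_not_mem ind_nonneg)
open scoped Classical symmDiff

variable {V : Type*} [Fintype V]

/-! ### The node -/

/-- **Polarised hub covariance bound for `φ_{w,q}` on every finite weighted graph**: for every weight vector `w` on `Fin n`, every pair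
`g`, hub `x` and pair `y, z`, the bound polarised between `φ_{w[g↦0]}` (delete `g`) and `φ_{w[g↦1]}` (contract `g`).
[cite: Grimmett2006, §3.9 eq. (3.94) (p. 63); Thm. (3.1)(a) (p. 37)] -/
def PolHubCovFK (q : ℝ) : Prop :=
  ∀ (n : ℕ) (w : Sym2 (Fin n) → unitInterval) (g : Sym2 (Fin n)) (x y z : Fin n),
    PolHubCovUnder (rcMeasureW (Function.update w g 0) q ∅) (rcMeasureW (Function.update w g 1) q ∅) q x y z

/-- **Polarised hub covariance bound for every `0 < q < 1`.**  CONJECTURE-SHAPED STATEMENT, NOT asserted: for `P⁰ = φ_{G∖g}`,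
`P¹ = φ_{G/g}`, `N = {x≁y, x≁z}`, `C = {x↔y↔z}`:
`(1 − q)·[P⁰(N)P¹(C) + P¹(N)P⁰(C) − P⁰(xy|z)P¹(xz|y) − P¹(xy|z)P⁰(xz|y)] ≤ P⁰(x≁y↔z) + P¹(x≁y↔z)`.
It implies `HubCovBoundFKLtOne` (= `EdgeNegCorrAdjFKLtOne`) by `hubCovBoundFKLtOne_of_polHubCovFKLtOne`; evidence bschramm/FK-BARRIER.md
§11.6 (0/13,350 numerically, `n ≤ 9`). [cite: Grimmett2006, §3.9 (pp. 63–66)] [cite: Wagner2006, Conj. 5.3 (p. 13)] -/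
@[conjecture] def PolHubCovFKLtOne : Prop := ∀ q : ℝ, 0 < q → q < 1 → PolHubCovFK q

/-! ### The chain `POL ⇒ HubCovBound ⇔ adjacent-edge NC` -/

/-- **`PolHubCovFK q → HubCovBoundFK q`** (`0 < q`; induction on undecided pairs, file 4). [cite: Grimmett2006, §3.9 eq. (3.94) (p. 63)] -/
theorem hubCovBoundFK_of_polHubCovFK {q : ℝ} (hq0 : 0 < q) (h : PolHubCovFK q) : HubCovBoundFK q := by
  intro n w x y z
  refine hubCovBoundUnder_of_pol hq0 x y z (fun v g => ?_) w
  -- the `Fin n` and the classical `DecidableEq` instances inside `Function.update` agree (subsingleton)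
  convert h n v g x y z using 4

/-- **`PolHubCovFKLtOne → HubCovBoundFKLtOne`.** [cite: Grimmett2006, §3.9 (p. 63)] -/
theorem hubCovBoundFKLtOne_of_polHubCovFKLtOne (h : PolHubCovFKLtOne) : HubCovBoundFKLtOne :=
  fun q hq0 hq1 => hubCovBoundFK_of_polHubCovFK hq0 (h q hq0 hq1)

/-- **`PolHubCovFKLtOne → EdgeNegCorrAdjFKLtOne`**: a proof of the polarised bound proves negative correlation of adjacent edges for
every `q < 1`. [cite: Grimmett2006, §3.9 (p. 63)] [cite: Wagner2006, Conj. 5.3 (p. 13)] -/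
theorem edgeNegCorrAdjFKLtOne_of_polHubCovFKLtOne (h : PolHubCovFKLtOne) : EdgeNegCorrAdjFKLtOne :=
  edgeNegCorrAdjFKLtOne_of_hubCovBoundFKLtOne (hubCovBoundFKLtOne_of_polHubCovFKLtOne h)


/-! ### At the hub pairs the polarised bound is the bound of the deleted state -/

/-- **At the hub pair `g = xy` the polarised term IS the three-point expression of the deleted state**: for `x ≠ y`, `0 < q`,
`PolHubCovUnder (φ_{w[xy↦0]}) (φ_{w[xy↦1]}) q x y z ↔ HubCovBoundUnder (φ_{w[xy↦0]}) q x y z` (from the pinning identity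
`TP_v = (1 − v(xy))·TP_{v[xy↦0]}` and the affine expansion at `v = w[xy ↦ ½]`, the contracted corner vanishing).
[cite: Grimmett2006, Thm. (3.1)(a) (p. 37); §3.9 eq. (3.94) (p. 63)] -/
theorem polHubCovUnder_hub_pair {q : ℝ} (hq0 : 0 < q) (w : Sym2 V → unitInterval) (x y z : V) (hxy : x ≠ y) :
    PolHubCovUnder (rcMeasureW (Function.update w s(x, y) 0) q ∅) (rcMeasureW (Function.update w s(x, y) 1) q ∅) q x y z ↔
      HubCovBoundUnder (rcMeasureW (Function.update w s(x, y) 0) q ∅) q x y z := by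
  rw [polHubCovUnder_iff_masses hq0, hubCovBoundUnder_iff_threePointN hq0]
  set half : unitInterval := ⟨2⁻¹, by norm_num, by norm_num⟩ with hhalf
  set v : Sym2 V → unitInterval := Function.update w s(x, y) half with hv
  have hv0 : Function.update v s(x, y) 0 = Function.update w s(x, y) 0 := by rw [hv, Function.update_idem]
  have hv1 : Function.update v s(x, y) 1 = Function.update w s(x, y) 1 := by rw [hv, Function.update_idem]
  have hvp : ((v s(x, y) : unitInterval) : ℝ) = 2⁻¹ := by rw [hv, Function.update_self]
  have h1 := threePoint_update_hub_pair v hq0.ne' x y z hxy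
  have h2 := threePoint_affine_expand v q s(x, y) x y z
  rw [hv0, hvp] at h1
  rw [hv0, hv1, hvp] at h2
  -- normal forms: `N = Byz + A` for `v` and `w[xy↦0]`; the separated patterns vanish under `w[xy↦1]`
  rw [mass_sees_neither_split v q x y z, mass_sees_neither_split (Function.update w s(x, y) 0) q x y z,
    sum_update_one_compl_openConn_inter w q x y (openConn x z : Set (BondConfig V))ᶜ,
    sum_update_one_compl_openConn_inter w q x y (openConn y z), sum_update_one_compl_openConn_inter w q x y (openConn x z)] at h2
  rw [mass_sees_neither_split (Function.update w s(x, y) 0) q x y z,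
    sum_update_one_compl_openConn_inter w q x y (openConn x z : Set (BondConfig V))ᶜ,
    sum_update_one_compl_openConn_inter w q x y (openConn y z), sum_update_one_compl_openConn_inter w q x y (openConn x z)]
  have key :
      (∑ ω : BondConfig V, rcWeightW (Function.update w s(x, y) 0) q ∅ ω * ind ((openConn x y : Set (BondConfig V))ᶜ ∩ openConn y z) ω) *
            rcPartitionFunctionW (Function.update w s(x, y) 1) q ∅ +
          0 * rcPartitionFunctionW (Function.update w s(x, y) 0) q ∅ -
        (1 - q) *
          ((∑ ω : BondConfig V, rcWeightW (Function.update w s(x, y) 0) q ∅ ω * ind ((openConn x y : Set (BondConfig V))ᶜ ∩ openConn y z) ω +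
                ∑ ω : BondConfig V, rcWeightW (Function.update w s(x, y) 0) q ∅ ω *
                  ind ((openConn x y : Set (BondConfig V))ᶜ ∩ (openConn x z : Set (BondConfig V))ᶜ ∩ (openConn y z : Set (BondConfig V))ᶜ) ω) *
              (∑ ω : BondConfig V, rcWeightW (Function.update w s(x, y) 1) q ∅ ω * ind (openConn x y ∩ openConn x z) ω) +
            0 * (∑ ω : BondConfig V, rcWeightW (Function.update w s(x, y) 0) q ∅ ω * ind (openConn x y ∩ openConn x z) ω) -
            (∑ ω : BondConfig V, rcWeightW (Function.update w s(x, y) 0) q ∅ ω * ind (openConn x y ∩ (openConn x z : Set (BondConfig V))ᶜ) ω) * 0 -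
            (∑ ω : BondConfig V, rcWeightW (Function.update w s(x, y) 1) q ∅ ω * ind (openConn x y ∩ (openConn x z : Set (BondConfig V))ᶜ) ω) *
              (∑ ω : BondConfig V, rcWeightW (Function.update w s(x, y) 0) q ∅ ω * ind ((openConn x y : Set (BondConfig V))ᶜ ∩ openConn x z) ω)) =
      (∑ ω : BondConfig V, rcWeightW (Function.update w s(x, y) 0) q ∅ ω * ind ((openConn x y : Set (BondConfig V))ᶜ ∩ openConn y z) ω) *
            rcPartitionFunctionW (Function.update w s(x, y) 0) q ∅ -
          (1 - q) *
            ((∑ ω : BondConfig V, rcWeightW (Function.update w s(x, y) 0) q ∅ ω * ind ((openConn x y : Set (BondConfig V))ᶜ ∩ openConn y z) ω +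
                ∑ ω : BondConfig V, rcWeightW (Function.update w s(x, y) 0) q ∅ ω *
                  ind ((openConn x y : Set (BondConfig V))ᶜ ∩ (openConn x z : Set (BondConfig V))ᶜ ∩ (openConn y z : Set (BondConfig V))ᶜ) ω) *
              (∑ ω : BondConfig V, rcWeightW (Function.update w s(x, y) 0) q ∅ ω * ind (openConn x y ∩ openConn x z) ω) -
             (∑ ω : BondConfig V, rcWeightW (Function.update w s(x, y) 0) q ∅ ω * ind (openConn x y ∩ (openConn x z : Set (BondConfig V))ᶜ) ω) *
              (∑ ω : BondConfig V, rcWeightW (Function.update w s(x, y) 0) q ∅ ω * ind ((openConn x y : Set (BondConfig V))ᶜ ∩ openConn x z) ω)) := by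
    linear_combination (-4) * h2 + 4 * h1
  rw [key]

end FK

end Summit.CriticalPhenomena.PercolationContinuityZ3.Theorems

end
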